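import Mathlib
import Summits.RiemannHypothesis.RiemannHypothesis.Theses.MayerPairing
import Summits.RiemannHypothesis.RiemannHypothesis.Theorems.MayerPairingEigenvaluePredicate
import Literature.Dynamics.TransferOperators.ChangMayerEigenfunction
import Literature.Dynamics.TransferOperators.MayerTransferOperatorHolomorphy
import Literature.Dynamics.TransferOperators.MayerTransferCompact
import Literature.NumberTheory.LFunctions.RHWave0

/-!
# Line `eisenstein-defect-coefficient` for crux `MayerPairing.BranchPairing` (stmt-RiemannHypothesis-1471)

Skeleton (crux-plan, round 1, gen 1) of the crux idea `eisenstein-defect-coefficient`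
(crux-ideate r1 ideator 2; triage r1: pass ×3 "as the identity toolkit / scalar shadow of the
rank-one pinning lever — keep ONE Eisenstein-channel line", TRIAGE-r1-1/2/3.md), written as the
ONE merged "Eisenstein channel" line the panel asked for.

THE OBJECTS (all over tree declarations `Literature.Dynamics.TransferOperators.mayerTransfer`,
`MayerSpace`, `MayerSpace.evalCLM`, `zagierPsi`).
* the Eisenstein DEFECT: `L_s f_s = f_s - (ζ(2s)/2)·𝟙`, `f_s = ψ(2s, ·+1) ∈ B(D)`, `f_s(0) = ζ(2s-1) ≠ 0`
  on the open strip `0 < Re s < 1/2` (tree: `mayerTransfer_zagierPsi_toFun`, `zagierPsi_one`,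
  `riemannZeta_sub_one_ne_zero`);
* the DEFECT COEFFICIENT `Φ(s,1) = δ₀((1 - L_s)⁻¹ 𝟙) = 2ζ(2s-1)/ζ(2s)` (the card's First lemma,
  PROVED below as `channel_one_closedForm`) and its reciprocal, the COUPLING
  `c(s) = ζ(2s)/(2ζ(2s-1))` (`coupling`);
* the PENCIL `L_s + κK`, `K = |𝟙⟩⟨δ₀|` (`pencil`, `defectOp`), PINNED at `κ = c(s)`:
  `(L_s + c(s)K) f_s = f_s` for EVERY `s` in the strip (PROVED below, `pinned_eigenvector`; the same
  lemma the three rank-one cards call PinnedEigenvector / FrozenEigenvalueOne);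
* the (pinned) EISENSTEIN CHANNEL FUNCTION `G̃(s,κ,μ) = δ₀((μ - L_s - κK)⁻¹ 𝟙)` (`pinnedChannel`,
  via Mathlib's `resolvent`; `κ = 0` is the card's `D(s,μ) = μ⁻¹Φ(s,μ⁻¹)`): the Weinstein–Aronszajn
  perturbation determinant of the rank-one passage `L_s + κK ↦ L_s` on a resolvent point `μ` is the
  SCALAR `1 + κ G̃(s,κ,μ)`.

THE LINE (for an off-line zero `ρ`, segment `σ ∈ [Re ρ/2, (1-Re ρ)/2]`, `s = σ + i Im ρ/2`).
`stub_eisensteinBeadCertificate` (THE BET: along the segment the pinned eigenvalue `1` of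
`L_s + c(s)K` is isolated by a moving radius `R(σ)` and algebraically simple, and on a smaller moving
circle `|μ-1| = R'(σ) < R(σ)`, `R'` continuous, the scalar `|c(s) G̃(s,c(s),μ)| < 1`)
⟹ `stub_weinsteinAronszajnCount` (ζ-free operator lemma: W–A formula of the second kind + Rouché:
`L_s` has exactly ONE spectral point `m(σ)` in the closed disc `|μ-1| ≤ R'(σ)`, an eigenvalue, inside
the open disc)
⟹ `stub_isolatedEigenvalueContinuous` (ζ-free Kato lemma for the holomorphic family `s ↦ L_s`:
a spectral singleton in a continuously moving disc moves continuously) gives `Λ := m` continuous;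
the ENDPOINTS are forced by `ζ ρ = 0`: at `σ = Re ρ/2` (`2s = ρ`) and `σ = (1-Re ρ)/2`
(`2s = 1 - ρ̄`, functional equation + conjugation) the dictionary (tree:
`exists_eigenfunction_of_riemannZeta_eq_zero`) puts `1` in the spectrum, inside the disc, so
`m = 1` there; the in-tree predicate bridge `mayerPairing_branchPairing_iff_operator` turns the
operator statement into the route's inlined predicate. On-line zeros (`Re ρ = 1/2`): the segment is
the point `1/4` and `Λ ≡ 1` is the dictionary. Composition `BranchPairing_of` below: no `sorry` of
its own; `sorryAx` enters only through the three registered `stub_*`.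

DISPROOF USED (Cruxes/BranchPairing/Disproof.lean v6, cdisprove): the line uses `H : ζ ρ = 0` twice —
in the bet (stated for zeros only) and at BOTH endpoint identifications (`m = 1` because `1 ∈ spec`,
i.e. the dictionary at `ρ/2` and at `(1-ρ̄)/2`), honouring `branchPairing_false_without_zero` /
`not_withoutZero_of_ucc`; continuity of `Λ` is DERIVED (stub 3 from the isolation in stub 1), which is
where `withoutContinuity_of_dict_of_nonempty` says the content must sit; no global sheet, anchor,
vertical pairing or mirror symmetry is used (`not_eisensteinSheet`, `eisensteinSheet_of_gaussKuzminAnchoring`,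
`not_verticalPairing`, `not_mirrorSymmetryConjInv`, `not_modulusPairing` are all respected: the bet is
LOCAL to the horizontal segment of one zero and concerns the eigenvalue EXACTLY 1 through `c(s)`).
No Negative lemma has landed under Theorems/BranchPairing/Negative (nothing to import).
-/

set_option linter.unusedVariables false
set_option linter.dupNamespace false

noncomputable section

namespace Summit.RiemannHypothesis.RiemannHypothesis.Cruxes.BranchPairing.EisensteinDefectCoefficient

open Summit.RiemannHypothesis.RiemannHypothesis.Theses.MayerPairing
open Literature.Dynamics.TransferOperators
open Filter Topology ComplexConjugate Metric

/-! ## §1 Objects -/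

/-- The parameter `s = σ + i·(Im ρ)/2`, spelled exactly as in the route file. -/
def sPar (σ : ℝ) (ρ : ℂ) : ℂ := (σ : ℂ) + ((ρ.im / 2 : ℝ) : ℂ) * Complex.I

/-- The constant function `𝟙 ∈ B(D)`. -/
def oneB : MayerSpace := MayerSpace.mk (fun _ => 1) continuousOn_const (differentiableOn_const 1)

/-- The evaluation functional `δ₀ : B(D) →L ℂ`, `δ₀ f = f(0)`. -/
def evalZero : MayerSpace →L[ℂ] ℂ := MayerSpace.evalCLM ⟨0, zero_mem_mayerClosedDisc⟩

/-- The rank-one DEFECT OPERATOR `K = |𝟙⟩⟨δ₀|`, `K f = f(0)·𝟙`. -/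
def defectOp : MayerSpace →L[ℂ] MayerSpace := evalZero.smulRight oneB

/-- The COUPLING `c(s) = ζ(2s) / (2 ζ(2s-1))` — the reciprocal of the Eisenstein defect coefficient
`Φ(s,1) = 2ζ(2s-1)/ζ(2s)`; finite on the open strip (`ζ(2s-1) ≠ 0` there) and `= 0` exactly at the
half-zeros `s = ρ/2`. -/
def coupling (s : ℂ) : ℂ := riemannZeta (2 * s) / (2 * riemannZeta (2 * s - 1))

/-- The PENCIL `L_s + κ K`. -/
def pencil (s κ : ℂ) : MayerSpace →L[ℂ] MayerSpace := mayerTransfer s + κ • defectOp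

/-- The PINNED operator `L̃_s = L_s + c(s) K`. -/
abbrev pinned (s : ℂ) : MayerSpace →L[ℂ] MayerSpace := pencil s (coupling s)

/-- The (pinned) EISENSTEIN CHANNEL FUNCTION `G̃(s, κ, μ) = δ₀((μ - (L_s + κK))⁻¹ 𝟙)` (Mathlib's
`resolvent`, hence the junk value `δ₀(0·𝟙) = 0` on the spectrum; it is only ever evaluated on
resolvent points below). `κ = 0` gives the card's channel `D(s, μ) = δ₀((μ - L_s)⁻¹ 𝟙) = μ⁻¹ Φ(s, μ⁻¹)`. -/
def pinnedChannel (s κ μ : ℂ) : ℂ := evalZero (resolvent (pencil s κ) μ oneB)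

/-- The card's channel / defect-coefficient function at `w = 1/μ`: `D(s, μ) = δ₀((μ - L_s)⁻¹ 𝟙)`. -/
def channel (s μ : ℂ) : ℂ := evalZero (resolvent (mayerTransfer s) μ oneB)

/-- The root space (maximal generalised eigenspace) of `T` at the eigenvalue `1`; its `finrank` is the
algebraic multiplicity (finite for compact `T`). -/
abbrev rootSpaceOne (T : MayerSpace →L[ℂ] MayerSpace) : Submodule ℂ MayerSpace :=
  Module.End.maxGenEigenspace (T : Module.End ℂ MayerSpace) 1

/-! ## §2 Small certified facts (no `sorry`) -/

lemma sPar_re (σ : ℝ) (ρ : ℂ) : (sPar σ ρ).re = σ := by simp [sPar]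

lemma two_mul_sPar_left (ρ : ℂ) : 2 * sPar (ρ.re / 2) ρ = ρ := by
  apply Complex.ext
  · simp only [sPar, Complex.mul_re, Complex.add_re, Complex.ofReal_re, Complex.ofReal_im,
      Complex.I_re, Complex.I_im, Complex.mul_im, Complex.add_im, Complex.re_ofNat,
      Complex.im_ofNat]
    ring
  · simp only [sPar, Complex.mul_re, Complex.add_re, Complex.ofReal_re, Complex.ofReal_im,
      Complex.I_re, Complex.I_im, Complex.mul_im, Complex.add_im, Complex.re_ofNat,
      Complex.im_ofNat]
    ring

lemma two_mul_sPar_right (ρ : ℂ) : 2 * sPar ((1 - ρ.re) / 2) ρ = 1 - conj ρ := by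
  apply Complex.ext
  · simp only [sPar, Complex.mul_re, Complex.add_re, Complex.ofReal_re, Complex.ofReal_im,
      Complex.I_re, Complex.I_im, Complex.mul_im, Complex.add_im, Complex.re_ofNat,
      Complex.im_ofNat, Complex.sub_re, Complex.one_re, Complex.conj_re]
    ring
  · simp only [sPar, Complex.mul_re, Complex.add_re, Complex.ofReal_re, Complex.ofReal_im,
      Complex.I_re, Complex.I_im, Complex.mul_im, Complex.add_im, Complex.re_ofNat,
      Complex.im_ofNat, Complex.sub_im, Complex.one_im, Complex.conj_im]
    ring

/-- The reflection of a zero in the critical line is a zero (Mathlib functional equation +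
conjugation symmetry; inlined to keep the import cone light). -/
lemma riemannZeta_one_sub_conj_eq_zero' {ρ : ℂ} (hζ : riemannZeta ρ = 0) (h0 : 0 < ρ.re)
    (him : ρ.im ≠ 0) : riemannZeta (1 - conj ρ) = 0 := by
  have hconj : riemannZeta (conj ρ) = 0 := by rw [riemannZeta_conj, hζ, map_zero]
  have hn : ∀ n : ℕ, conj ρ ≠ -(n : ℂ) := by
    intro n h
    have := congrArg Complex.re h
    simp at this
    have : (0 : ℝ) ≤ n := n.cast_nonneg
    linarith
  have h1 : conj ρ ≠ 1 := by
    intro h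
    have := congrArg Complex.im h
    simp at this
    exact him this
  rw [riemannZeta_one_sub hn h1, hconj, mul_zero]

/-- An eigenvalue of a bounded operator on `B(D)` lies in its spectrum (in the Banach algebra of
bounded operators; Mathlib's `ContinuousLinearMap.spectrum_eq` + `HasEigenvalue.mem_spectrum`). -/
lemma mem_spectrum_of_eigen {T : MayerSpace →L[ℂ] MayerSpace} {μ : ℂ} {g : MayerSpace}
    (hg : g ≠ 0) (h : T g = μ • g) : μ ∈ spectrum ℂ T := by
  rw [ContinuousLinearMap.spectrum_eq]
  refine Module.End.HasEigenvalue.mem_spectrum (Module.End.hasEigenvalue_of_hasEigenvector ⟨?_, hg⟩)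
  exact Module.End.mem_eigenspace_iff.2 h

/-- Point values of `𝟙`. -/
lemma oneB_toFun {z : ℂ} (hz : z ∈ mayerClosedDisc) : oneB.toFun z = 1 :=
  MayerSpace.mk_toFun_apply _ _ _ hz

/-- **The pinned Eisenstein eigenvector** (the defect identity, repackaged; = the First lemma
`PinnedEigenvector` / `FrozenEigenvalueOne` of the sibling rank-one cards, here PROVED): for
`0 < Re s < 1/2` the element `f_s = ψ(2s, ·+1) ∈ B(D)` is a nonzero eigenvector of the pinned
operator `L_s + c(s)K` with eigenvalue `1`, and `δ₀ f_s = ζ(2s-1)`. One line from the tree's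
`mayerTransfer_zagierPsi_toFun` (`L_s f_s = f_s - ζ(2s)/2`), `zagierPsi_one`, `riemannZeta_sub_one_ne_zero`. -/
theorem pinned_eigenvector {s : ℂ} (h0 : 0 < s.re) (h1 : s.re < 1 / 2) :
    ∃ g : MayerSpace, g ≠ 0 ∧ pinned s g = g ∧ evalZero g = riemannZeta (2 * s - 1) := by
  have hσ0 : 0 < (2 * s).re := by simp; linarith
  have hσ1 : (2 * s).re < 1 := by simp; linarith
  have hσ : 2 * s ∈ psiDomain := ⟨hσ0, Or.inr hσ1⟩
  have hne1 : 2 * s ≠ 1 := (ne_one_of_mem_psiDomain hσ).1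
  have hζ1 : riemannZeta (2 * s - 1) ≠ 0 := riemannZeta_sub_one_ne_zero hσ0 hσ1
  let g : MayerSpace := MayerSpace.mk (fun u => zagierPsi (2 * s) (u + 1))
      (continuousOn_zagierPsi_add_one (ne_one_of_mem_psiDomain hσ).1 hσ.1)
      (differentiableOn_zagierPsi_add_one_mayerDisc (ne_one_of_mem_psiDomain hσ).1 hσ.1)
  have hval : ∀ z ∈ mayerClosedDisc, g.toFun z = zagierPsi (2 * s) (z + 1) := fun z hz =>
    MayerSpace.mk_toFun_apply _ _ _ hz
  have hg0 : g.toFun 0 = riemannZeta (2 * s - 1) := by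
    rw [hval 0 zero_mem_mayerClosedDisc, zero_add, zagierPsi_one hσ]
  have hL : ∀ z ∈ mayerClosedDisc,
      (mayerTransfer s g).toFun z = zagierPsi (2 * s) (z + 1) - riemannZeta (2 * s) / 2 :=
    fun z hz => mayerTransfer_zagierPsi_toFun hσ ⟨z, hz⟩
  have hev : evalZero g = riemannZeta (2 * s - 1) := by
    rw [← hg0]
    exact MayerSpace.evalCLM_apply _ _
  refine ⟨g, ?_, ?_, hev⟩
  · intro h
    apply hζ1
    rw [← hg0, h]
    simp [MayerSpace.toFun]
  · apply MayerSpace.ext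
    intro z hz
    have hK : (pinned s g) = mayerTransfer s g + coupling s • (evalZero g • oneB) := by
      simp only [pinned, pencil, defectOp, ContinuousLinearMap.add_apply,
        ContinuousLinearMap.smul_apply, ContinuousLinearMap.smulRight_apply]
    rw [hK, MayerSpace.toFun_add_apply _ _ hz, MayerSpace.toFun_smul_apply _ _ hz,
      MayerSpace.toFun_smul_apply _ _ hz, hL z hz, hev, oneB_toFun hz, hval z hz, coupling]
    field_simp
    ring

/-- **The Eisenstein defect coefficient in closed form** (the card's First lemma
`EisensteinCoefficientClosedForm`, PROVED; the scalar reading of `pinned_eigenvector`): whenever `1`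
is a resolvent point of `L_s` (`0 < Re s < 1/2`), `ζ(2s) ≠ 0` and
`Φ(s,1) = D(s,1) = δ₀((1 - L_s)⁻¹𝟙) = 2ζ(2s-1)/ζ(2s)`, i.e. `c(s)·Φ(s,1) = 1` — the value `μ = 1`
solves the W–A secular equation of the pinned pencil at full coupling for EVERY such `s`; the zeros
of `ζ(2s)` are exactly where this solution is a pole of the channel. (Numerically verified across the
strip by the ideator, j005511; rel. error ≤ 2.5e-5 in j013317.) -/
theorem channel_one_closedForm {s : ℂ} (h0 : 0 < s.re) (h1 : s.re < 1 / 2)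
    (hres : (1 : ℂ) ∈ resolventSet ℂ (mayerTransfer s)) :
    riemannZeta (2 * s) ≠ 0 ∧
      channel s 1 = 2 * riemannZeta (2 * s - 1) / riemannZeta (2 * s) := by
  obtain ⟨g, hg0, hg1, hev⟩ := pinned_eigenvector h0 h1
  have hσ0 : 0 < (2 * s).re := by simp; linarith
  have hσ1 : (2 * s).re < 1 := by simp; linarith
  have hζ1 : riemannZeta (2 * s - 1) ≠ 0 := riemannZeta_sub_one_ne_zero hσ0 hσ1
  have hu : IsUnit ((1 : MayerSpace →L[ℂ] MayerSpace) - mayerTransfer s) := by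
    have h : IsUnit (algebraMap ℂ (MayerSpace →L[ℂ] MayerSpace) 1 - mayerTransfer s) := hres
    rwa [map_one] at h
  have hchan : channel s 1 = evalZero (Ring.inverse ((1 : MayerSpace →L[ℂ] MayerSpace) -
      mayerTransfer s) oneB) := by
    unfold channel resolvent
    rw [map_one]
  set u : MayerSpace →L[ℂ] MayerSpace := (1 : MayerSpace →L[ℂ] MayerSpace) - mayerTransfer s
    with hu_def
  -- the defect identity in operator form: `(1 - L_s) f_s = (ζ(2s)/2) • 𝟙`
  have h := hg1
  simp only [pinned, pencil, defectOp, ContinuousLinearMap.add_apply,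
    ContinuousLinearMap.smul_apply, ContinuousLinearMap.smulRight_apply, hev, smul_smul] at h
  have hc : coupling s * riemannZeta (2 * s - 1) = riemannZeta (2 * s) / 2 := by
    unfold coupling
    field_simp
  rw [hc] at h
  have hug : u g = g - mayerTransfer s g := by
    simp only [hu_def, ContinuousLinearMap.sub_apply, ContinuousLinearMap.one_apply]
  have hdef : u g = (riemannZeta (2 * s) / 2) • oneB := by
    rw [hug]
    exact sub_eq_of_eq_add' h.symm
  -- invert `u`
  have hinv : Ring.inverse u * u = 1 := Ring.inverse_mul_cancel u hu
  have hg : Ring.inverse u (u g) = g := by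
    have := congrArg (fun T : MayerSpace →L[ℂ] MayerSpace => T g) hinv
    simpa only [ContinuousLinearMap.mul_apply, ContinuousLinearMap.one_apply] using this
  rw [hdef, map_smul] at hg
  have hζ : riemannZeta (2 * s) ≠ 0 := by
    intro hz
    apply hg0
    rw [← hg, hz]
    simp
  have key := congrArg evalZero hg
  rw [map_smul, hev, smul_eq_mul] at key
  refine ⟨hζ, ?_⟩
  rw [hchan]
  field_simp
  linear_combination 2 * key

/-! ## §3 The statements of the line -/

/-- **W–A COUNT** (landing type of `stub_weinsteinAronszajnCount`; ζ-free, about ONE compact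
operator `L_s` and its rank-one pencil). If, for some coupling `κ` and radii `0 < R' < R`,
(i) the pencil `L_s + κK` has no spectrum in the closed disc `|μ - 1| ≤ R` other than `1`,
(ii) `1` is an eigenvalue of `L_s + κK` of algebraic multiplicity one, and
(iii) on the circle `|μ - 1| = R'` the scalar W–A determinant stays in the unit disc around `1`:
`|κ · G̃(s,κ,μ)| < 1`, `G̃(s,κ,μ) = δ₀((μ - L_s - κK)⁻¹𝟙)`,
then `L_s = (L_s + κK) - κK` has exactly one spectral point `m` in the closed disc `|μ - 1| ≤ R'`, it
lies in the open disc and is an eigenvalue. Reason: `μ - L_s = (μ - L̃)(1 + κ (μ - L̃)⁻¹|𝟙⟩⟨δ₀|)`, the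
rank-one determinant is `1 + κ G̃(μ)`, which does not wind around `0` on the circle, so the
eigenvalue counts (with algebraic multiplicity, both operators compact: tree
`MayerTransferCompact_holds` + finite rank) of `L_s` and `L̃` inside the circle agree (Kato IV §6,
W–A formula of the second kind; Rouché). Size L in Lean (no Riesz-projection / perturbation-determinant
API in Mathlib). -/
def WeinsteinAronszajnCount : Prop :=
  ∀ (s κ : ℂ) (R R' : ℝ), 0 < s.re → s.re < 1 / 2 → 0 < R' → R' < R →
    spectrum ℂ (pencil s κ) ∩ closedBall (1 : ℂ) R ⊆ {1} →
    Module.finrank ℂ (rootSpaceOne (pencil s κ)) = 1 →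
    (∀ μ : ℂ, ‖μ - 1‖ = R' → ‖κ * pinnedChannel s κ μ‖ < 1) →
    ∃ m : ℂ, ∃ g : MayerSpace, g ≠ 0 ∧ mayerTransfer s g = m • g ∧
      spectrum ℂ (mayerTransfer s) ∩ closedBall (1 : ℂ) R' = {m} ∧ ‖m - 1‖ < R'

/-- **ISOLATED-EIGENVALUE CONTINUITY** (landing type of `stub_isolatedEigenvalueContinuous`;
ζ-free, about the holomorphic family `s ↦ L_s`, tree `MayerTransferHolomorphic_holds`). Along a
horizontal segment `σ ∈ [a,b] ⊂ (0, 1/2)` at height `τ`: if a CONTINUOUS radius `r(σ) > 0` isolates a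
spectral singleton `{m(σ)}` of `L_{σ+iτ}` in the closed disc `|μ - 1| ≤ r(σ)`, strictly inside, then
`σ ↦ m(σ)` is continuous. Reason: upper semicontinuity of the spectrum
(`upperHemicontinuous_spectrum` (Mathlib Analysis/Normed/Algebra/Spectrum)) plus persistence of an isolated spectral point under
norm-small perturbation (rank of the Riesz projection is locally constant; Kato IV §3.4–3.5,
Thm 3.16). Size M–L in Lean. -/
def IsolatedEigenvalueContinuous : Prop :=
  ∀ (τ a b : ℝ) (r : ℝ → ℝ) (m : ℝ → ℂ), 0 < a → a ≤ b → b < 1 / 2 →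
    ContinuousOn r (Set.Icc a b) →
    (∀ σ ∈ Set.Icc a b, 0 < r σ ∧
      spectrum ℂ (mayerTransfer ((σ : ℂ) + (τ : ℂ) * Complex.I)) ∩ closedBall (1 : ℂ) (r σ) =
        {m σ} ∧ ‖m σ - 1‖ < r σ) →
    ContinuousOn m (Set.Icc a b)

/-- **THE EISENSTEIN BEAD CERTIFICATE for one zero `ρ`** (the body of THE BET
`EisensteinBeadCertificate` = landing type of `stub_eisensteinBeadCertificate`; crux-strength off the
critical line, testable content on it). Along the segment `σ ∈ [Re ρ/2, (1 - Re ρ)/2]`,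
`s = σ + i Im ρ/2`, there are radii `R(σ) > R'(σ) > 0`, `R'` CONTINUOUS and `< 1`, such that
(iso) the pinned operator `L_s + c(s)K` has no spectrum in `|μ - 1| ≤ R(σ)` other than its pinned
eigenvalue `1` (`pinned_eigenvector`);
(simple) that eigenvalue has algebraic multiplicity `≤ 1` (hence `= 1`): `s` avoids the bad set
`B = {δ₀((1 - L̃_s)⁻² 𝟙) = 0}` of TRIAGE-r1-1;
(small) on the circle `|μ - 1| = R'(σ)` the scalar W–A determinant obeys `|c(s)·G̃(s,c(s),μ)| < 1`.
Near `μ = 1`, `G̃ = r(s)/(μ-1) + H(s,μ)` with residue `r(s) = ζ(2s-1)·ℓ̃(𝟙)/ℓ̃(f_s)`, so (small) asks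
for a radius between the DISPLACEMENT `ε(s) = |c(s) r(s)| = |ζ(2s)|·|ℓ̃(𝟙)|/(2|ℓ̃(f_s)|)` (up to the
regular part) and the pinned GAP `R(σ)`: the card's channel data (`Φ`, residue law
`-c'/λ' = ζ(ρ-1)/ζ'(ρ)` at the endpoints) are exactly `r`, `H`. ζ enters only through `c(s)` and the
restriction to zero heights. At the endpoints `c = 0`, (small) is vacuous and (iso)+(simple) say: the
eigenvalue `1` of `L_{ρ/2}` is isolated and algebraically simple. Under RH the segment is the point
`σ = 1/4` and the statement reduces to exactly that — its cheap falsifier (j013263 V: eigenvalue 1 at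
`ρ₂/2` isolated by 0.968). Numerics on FAKE segments (no zero; TRIAGE-r1-2 §2, j013317): pinned gap
`d ≥ 0.29`, but the first-order Rouché radius `2|c r|` fails the test for `σ ≤ 0.16–0.18` at heights
`γ₁/2, γ₂/2` and at 19/21 generic heights on `σ = 1/4` — only a TUBE around `σ = 1/4` and the
large-height regime are alive, and the large-height regime must beat eigenvalue crowding
(heuristically `#{|λ| > 1/2} ≍ τ` ⇒ gaps `≲ τ^{-1/2}`) with a displacement `ε(s)` that shows no decay
up to `τ = 20` (TRIAGE-r1-2 App. B). THIS SEAT'S OPTIMAL-RADIUS SCAN (kit j015017, N = 48, validated on the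
GKW spectrum and on the eigenvalue 1 at `ρ₁/2`): at `τ = γ₁/2` (resp. `γ₂/2`) SOME radius certifies (small)
exactly for `σ ≥ 0.18` (resp. `σ ≥ 0.20`) and NO radius does for `σ ≤ 0.16` (resp. `0.18`), where
`min_R' max_{|μ-1|=R'} |cG̃|` = 1.27 … 8.4; at the generic height `τ = 10` no σ is certified (1.03–1.16).
So on fake segments the clause is true for would-be zeros with `Re ρ ≥ 0.36–0.40` and false nearer the
strip edge at these heights. -/
def BeadCertificateAt (ρ : ℂ) : Prop :=
  ∃ R R' : ℝ → ℝ, ContinuousOn R' (Set.Icc (ρ.re / 2) ((1 - ρ.re) / 2)) ∧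
    ∀ σ ∈ Set.Icc (ρ.re / 2) ((1 - ρ.re) / 2),
      0 < R' σ ∧ R' σ < R σ ∧ R' σ < 1 ∧
      spectrum ℂ (pinned (sPar σ ρ)) ∩ closedBall (1 : ℂ) (R σ) ⊆ {1} ∧
      Module.Finite ℂ (rootSpaceOne (pinned (sPar σ ρ))) ∧
      Module.finrank ℂ (rootSpaceOne (pinned (sPar σ ρ))) ≤ 1 ∧
      ∀ μ : ℂ, ‖μ - 1‖ = R' σ →
        ‖coupling (sPar σ ρ) * pinnedChannel (sPar σ ρ) (coupling (sPar σ ρ)) μ‖ < 1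

/-- **THE BET** (landing type of `stub_eisensteinBeadCertificate`): the bead certificate
`BeadCertificateAt ρ` for EVERY zero `ρ` with `0 < Re ρ < 1/2`, `Im ρ > 14` (no height split; see
`EisensteinBeadCertificateAbove` / `eisensteinBeadCertificate_of_above` for the Platt–Trudgian
weakening a lead may prefer). -/
def EisensteinBeadCertificate : Prop :=
  ∀ ρ : ℂ, riemannZeta ρ = 0 → 0 < ρ.re → ρ.re < 1 / 2 → 14 < ρ.im → BeadCertificateAt ρ

/-- HIGH-ONLY form of the bet: the certificate only for zeros above height `H`. -/
def EisensteinBeadCertificateAbove (H : ℝ) : Prop :=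
  ∀ ρ : ℂ, riemannZeta ρ = 0 → 0 < ρ.re → ρ.re < 1 / 2 → H < ρ.im → BeadCertificateAt ρ

/-- **Height split (triage T4 made concrete).** Given the tree's named computational fact
`platt_trudgian_numerical_rh` (RH verified to height `3 000 175 332 800`, RHWave0), the bet is needed
only above that height: below it there are no zeros with `Re ρ < 1/2`, so `EisensteinBeadCertificate`
holds vacuously there. (Not used by `BranchPairing_of`; a lead who prefers the weaker bet replaces
`stub_eisensteinBeadCertificate` by this theorem applied to a HIGH-only stub plus the named fact.) -/
theorem eisensteinBeadCertificate_of_above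
    (hRH : Literature.NumberTheory.LFunctions.platt_trudgian_numerical_rh)
    (h : EisensteinBeadCertificateAbove 3000175332800) : EisensteinBeadCertificate := by
  intro ρ hζ h0 hlt h14
  by_cases hT : ρ.im ≤ 3000175332800
  · exact absurd (hRH ρ hζ (by linarith) hT) (ne_of_lt hlt)
  · exact h ρ hζ h0 hlt (lt_of_not_ge hT)

/-! ## §4 Registered stubs -/

/-- STUB 1 — THE BET (crux-strength; see `EisensteinBeadCertificate`). -/
theorem stub_eisensteinBeadCertificate : EisensteinBeadCertificate := by
  sorry

/-- STUB 2 — W–A COUNT (size L; Kato IV §6.1–6.2, W–A formulas; Rouché / argument principle for the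
scalar perturbation determinant `1 + κ G̃`; compactness of `L_s` from `MayerTransferCompact_holds`). -/
theorem stub_weinsteinAronszajnCount : WeinsteinAronszajnCount := by
  sorry

/-- STUB 3 — ISOLATED-EIGENVALUE CONTINUITY (size M–L; Kato IV Thm 3.16 / §3.5 for the
norm-continuous family `σ ↦ L_{σ+iτ}`, continuity from `MayerTransferHolomorphic_holds`). -/
theorem stub_isolatedEigenvalueContinuous : IsolatedEigenvalueContinuous := by
  sorry

/-! ## §5 The composition (kernel-checked; concludes the crux BY NAME; uses the stubs by name) -/

set_option synthInstance.maxHeartbeats 200000 in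
set_option maxHeartbeats 800000 in
/-- **`BranchPairing` from the three stubs.** Operator form by the in-tree bridge
`mayerPairing_branchPairing_iff_operator`; on the line `Λ ≡ 1` by the dictionary; off the line:
bet ⟹ (with `pinned_eigenvector`, multiplicity exactly one) W–A count at every `σ` ⟹ a spectral
singleton `m(σ)` in the moving disc, an eigenvalue, `≠ 0` (`|m - 1| < R' < 1`) ⟹ continuous by
stub 3 ⟹ `= 1` at both ends because `1 ∈ spec L_{ρ/2}` and `1 ∈ spec L_{(1-ρ̄)/2}` (dictionary at
`ζ ρ = 0` and `ζ(1 - ρ̄) = 0`) lie in the discs. No `sorry` of its own. -/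
theorem BranchPairing_of : BranchPairing := by
  rw [Summit.RiemannHypothesis.RiemannHypothesis.Theorems.mayerPairing_branchPairing_iff_operator]
  intro ρ hζ h0 hle h14
  rcases eq_or_lt_of_le hle with heq | hlt
  · -- ON THE LINE: the segment is the point `1/4`, `Λ ≡ 1` by the dictionary
    refine ⟨fun _ => 1, continuousOn_const, rfl, rfl, fun σ hσ => ⟨one_ne_zero, ?_⟩⟩
    obtain ⟨hσ1, hσ2⟩ := hσ
    have hσeq : σ = ρ.re / 2 := by
      rw [heq] at hσ1 hσ2 ⊢
      linarith
    have hs0 : 0 < (sPar σ ρ).re := by rw [sPar_re]; linarith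
    have hs1 : (sPar σ ρ).re < 1 / 2 := by rw [sPar_re]; linarith
    have hζ2 : riemannZeta (2 * sPar σ ρ) = 0 := by rw [hσeq, two_mul_sPar_left]; exact hζ
    obtain ⟨f, hf0, hf1, -⟩ := exists_eigenfunction_of_riemannZeta_eq_zero hs0 hs1 hζ2
    refine ⟨f, hf0, ?_⟩
    show mayerTransfer (sPar σ ρ) f = (1 : ℂ) • f
    rw [one_smul]
    exact hf1
  · -- OFF THE LINE: the three stubs
    have hab : ρ.re / 2 ≤ (1 - ρ.re) / 2 := by linarith
    obtain ⟨R, R', hR'c, hall⟩ := stub_eisensteinBeadCertificate ρ hζ h0 hlt h14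
    have hW : ∀ σ ∈ Set.Icc (ρ.re / 2) ((1 - ρ.re) / 2), ∃ m : ℂ, ∃ g : MayerSpace, g ≠ 0 ∧
        mayerTransfer (sPar σ ρ) g = m • g ∧
        spectrum ℂ (mayerTransfer (sPar σ ρ)) ∩ closedBall (1 : ℂ) (R' σ) = {m} ∧
        ‖m - 1‖ < R' σ := by
      intro σ hσ
      obtain ⟨hR'0, hR'R, -, hiso, hfin, hrank, hsmall⟩ := hall σ hσ
      have hs0 : 0 < (sPar σ ρ).re := by rw [sPar_re]; linarith [hσ.1]
      have hs1 : (sPar σ ρ).re < 1 / 2 := by rw [sPar_re]; linarith [hσ.2]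
      obtain ⟨g, hg0, hg1, -⟩ := pinned_eigenvector hs0 hs1
      have hmem : g ∈ rootSpaceOne (pinned (sPar σ ρ)) := by
        refine Module.End.genEigenspace_le_maximal _ _ 1 ?_
        refine Module.End.mem_eigenspace_iff.2 ?_
        show pinned (sPar σ ρ) g = (1 : ℂ) • g
        rw [one_smul]
        exact hg1
      have hpos : 0 < Module.finrank ℂ (rootSpaceOne (pinned (sPar σ ρ))) := by
        haveI := hfin
        haveI : Nontrivial (rootSpaceOne (pinned (sPar σ ρ))) :=
          ⟨⟨⟨g, hmem⟩, 0, fun h => hg0 (by simpa using congrArg Subtype.val h)⟩⟩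
        exact Module.finrank_pos (R := ℂ) (M := rootSpaceOne (pinned (sPar σ ρ)))
      have hrank1 : Module.finrank ℂ (rootSpaceOne (pinned (sPar σ ρ))) = 1 :=
        le_antisymm hrank hpos
      exact stub_weinsteinAronszajnCount (sPar σ ρ) (coupling (sPar σ ρ)) (R σ) (R' σ) hs0 hs1
        hR'0 hR'R hiso hrank1 hsmall
    choose! m g hm using hW
    have hR'0 : ∀ σ ∈ Set.Icc (ρ.re / 2) ((1 - ρ.re) / 2), 0 < R' σ := fun σ hσ => (hall σ hσ).1
    refine ⟨m, ?_, ?_, ?_, ?_⟩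
    · -- continuity of the selection (stub 3)
      refine stub_isolatedEigenvalueContinuous (ρ.im / 2) (ρ.re / 2) ((1 - ρ.re) / 2) R' m
        (by linarith) hab (by linarith) hR'c fun σ hσ => ?_
      obtain ⟨-, -, hspec, hlt'⟩ := hm σ hσ
      exact ⟨hR'0 σ hσ, hspec, hlt'⟩
    · -- left endpoint: `1 ∈ spec L_{ρ/2}` (dictionary) lies in the disc, so `m = 1`
      have hmemI : ρ.re / 2 ∈ Set.Icc (ρ.re / 2) ((1 - ρ.re) / 2) := ⟨le_rfl, hab⟩
      obtain ⟨-, -, hspec, -⟩ := hm _ hmemI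
      have hs0 : 0 < (sPar (ρ.re / 2) ρ).re := by rw [sPar_re]; linarith
      have hs1 : (sPar (ρ.re / 2) ρ).re < 1 / 2 := by rw [sPar_re]; linarith
      have hζ2 : riemannZeta (2 * sPar (ρ.re / 2) ρ) = 0 := by rw [two_mul_sPar_left]; exact hζ
      obtain ⟨f, hf0, hf1, -⟩ := exists_eigenfunction_of_riemannZeta_eq_zero hs0 hs1 hζ2
      have h1 : (1 : ℂ) ∈ spectrum ℂ (mayerTransfer (sPar (ρ.re / 2) ρ)) ∩
          closedBall (1 : ℂ) (R' (ρ.re / 2)) :=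
        ⟨mem_spectrum_of_eigen hf0 (by rw [one_smul]; exact hf1),
          mem_closedBall_self (hR'0 _ hmemI).le⟩
      rw [hspec] at h1
      exact (Set.mem_singleton_iff.1 h1).symm
    · -- right endpoint: `1 ∈ spec L_{(1-ρ̄)/2}` since `ζ(1 - ρ̄) = 0`
      have hmemI : (1 - ρ.re) / 2 ∈ Set.Icc (ρ.re / 2) ((1 - ρ.re) / 2) := ⟨hab, le_rfl⟩
      obtain ⟨-, -, hspec, -⟩ := hm _ hmemI
      have hs0 : 0 < (sPar ((1 - ρ.re) / 2) ρ).re := by rw [sPar_re]; linarith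
      have hs1 : (sPar ((1 - ρ.re) / 2) ρ).re < 1 / 2 := by rw [sPar_re]; linarith
      have hζ2 : riemannZeta (2 * sPar ((1 - ρ.re) / 2) ρ) = 0 := by
        rw [two_mul_sPar_right]
        exact riemannZeta_one_sub_conj_eq_zero' hζ h0 (by linarith)
      obtain ⟨f, hf0, hf1, -⟩ := exists_eigenfunction_of_riemannZeta_eq_zero hs0 hs1 hζ2
      have h1 : (1 : ℂ) ∈ spectrum ℂ (mayerTransfer (sPar ((1 - ρ.re) / 2) ρ)) ∩
          closedBall (1 : ℂ) (R' ((1 - ρ.re) / 2)) :=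
        ⟨mem_spectrum_of_eigen hf0 (by rw [one_smul]; exact hf1),
          mem_closedBall_self (hR'0 _ hmemI).le⟩
      rw [hspec] at h1
      exact (Set.mem_singleton_iff.1 h1).symm
    · -- the eigen-clause: `m σ ≠ 0` (it lies within `R' σ < 1` of `1`) with eigenvector `g σ`
      intro σ hσ
      obtain ⟨hg0, hLg, -, hlt'⟩ := hm σ hσ
      have hR'1 : R' σ < 1 := (hall σ hσ).2.2.1
      refine ⟨fun hm0 => ?_, g σ, hg0, hLg⟩
      rw [hm0, zero_sub, norm_neg, norm_one] at hlt'
      linarith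

end Summit.RiemannHypothesis.RiemannHypothesis.Cruxes.BranchPairing.EisensteinDefectCoefficient

end
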